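import Summits.BirchSwinnertonDyer.BirchSwinnertonDyer.Theorems.ByReductionTypeAtTwoFineSelmerConjAAtTwoAdditivePotGoodNarrowRankStamp445508b1
import Mathlib.Tactic.ComputeDegree
import HarnessLib

/-!
# C4″ `AdditivePotMultOverKAtTwo` (item stmt-BirchSwinnertonDyer-22618), the (I1M′) input on the `0 < Δ` rows:
# the NARROW-ROAD KIT — the generic (field-independent) half of k4-w1's zero-hypothesis narrow-Fukuda road
# (`conjA_two_445508b1''`), so that a census row only has to supply finite certificates about its totally real cubic field

Cell `bsd-2adic`, rung K4, seat `bsd-2adic-k4-w3` GEN 12 (explicit unit of director-bsd g16 (309)(7); `--supports stmt-BirchSwinnertonDyer-22618`).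
HONEST FRAMING (D-0036/D-0054/D-0152): THEOREMS ONLY (no definition, no named fact, no `sorry`, no instance). Generic plumbing; closes
nothing at the `∀`-level (C4″ / (I1M′) stay research-open); nothing booked; BSD is not proved by any of this.

THE ROAD (k4-w1 GEN 10, row `445508b1`; cruxlead-19573-w2 GEN 9 NARROW FUKUDA). For a census cubic model `y² = x³ + px² + qx + r`
with irreducible cubic and TOTALLY REAL `2`-torsion field `E = ℚ(β) = ℚ(θ)` (`θ` a root of a reduced generator of the same field):
Fukuda index `0` for every cyclotomic `ℤ₂`-extension of `E` and ONE equality of narrow `2`-ranks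
`[Cl⁺(A) : Cl⁺(A)²] = [Cl⁺(E) : Cl⁺(E)²]`, `A = E ⊔ ℚ_1 = E(√2)`, give Coates–Sujatha's statement (A) at `(W, 2)`
(`conjA_two_of_pointField_of_narrowRank_sqrtTwo_model`). Both indices are computed as `#(U⁺/U²)` once `h` is odd
(`index_range_pow_two_narrowClassGroup_eq_card_totPosUnitsModSq_of_odd_classNumber`). This file makes every step that does not
depend on the particular cubic a theorem with the cubic `⟨1, p, q, r⟩` as a parameter:

* §0 `sqrt_two_gt_rat` / `sqrt_two_lt_rat` (tight rational bounds on `√2`), `isIntegral_of_monic_sextic_eval` (an element killed by a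
  monic integer sextic is an algebraic integer — how half-integral units of `A` are certified).
* §1 `layer_one_basics` (`A` totally real, `[A:ℚ] = 6`, `[E:ℚ] = 3`), `exists_ringHom_sup_layer_one` (every pair `(φ, ±√2)` is a real
  embedding of `A`), `finrank_sup_layer_one_eq_two`, `sqrt_two_not_mem_range` — for ANY irreducible integer cubic with `E` totally real.
* §2–§4 in part B (`…NarrowRoadKitSquares`: non-square transfer `E → A`, `h(A)` odd from the one-bit currency, residue non-square
  criterion); §6, §5 in part C (`…NarrowRoadKitDoors`: the two `#(U⁺/U²) = 2` assemblies and the final door `conjA_two_cubicModel_of_narrowRoad`).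

References: [Fukuda1994] Thm. 1 (2), p. 264; [CoatesSujatha2005] Conj. A, Thm. 3.4; [FrohlichTaylor1990] Ch. V §1 (1.8)–(1.13);
[Washington1997] §13.1, Prop. 13.2; [Lang1990] Ch. 13 §4 Lemma 4.1; [Cohen1993] §4.1.3; [Marcus1977] Ch. 5 Thm. 22.
-/

set_option autoImplicit false
-- sibling precedent (`…NarrowRankStamp445508b1.lean`): the directory name repeats the summit name
set_option linter.dupNamespace false

noncomputable section

open scoped Classical IntermediateField NumberField

namespace Summit.BirchSwinnertonDyer.BirchSwinnertonDyer.Theorems.AddKatoTwo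

open WeierstrassCurve Field Polynomial IsDedekindDomain NumberField IntermediateField Literature.NumberTheory.EllipticCurves
  Literature.NumberTheory.EllipticCurves.ZpExtension
  Literature.NumberTheory.GaloisRepresentations Literature.NumberTheory.IwasawaTheory Literature.NumberTheory.NumberFields
  Literature.Geometry.Kaehler.ComplexTorus
  Summit.BirchSwinnertonDyer.BirchSwinnertonDyer.Theorems.AlignedTransportAtTwoTorsionPointField
  Summit.BirchSwinnertonDyer.BirchSwinnertonDyer.Theorems.SteinbergFibreAtTwo.NarrowRankCert

/-! ## §0 Elementary helpers -/

/-- `1.4142135623730950488 < √2` (rational lower bound, `20` digits). [folklore] -/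
theorem sqrt_two_gt_rat : (14142135623730950488 / 10000000000000000000 : ℝ) < Real.sqrt 2 := by
  rw [Real.lt_sqrt (by norm_num)]; norm_num

/-- `√2 < 1.4142135623730950489` (rational upper bound, `20` digits). [folklore] -/
theorem sqrt_two_lt_rat : Real.sqrt 2 < (14142135623730950489 / 10000000000000000000 : ℝ) := by
  rw [Real.sqrt_lt' (by norm_num)]; norm_num

/-- **An element of a field killed by a MONIC INTEGER SEXTIC is an algebraic integer** (how the half-integral units
`(a + c√2)/2` of `A = ℚ(θ, √2)` are certified: the generator supplies the sextic `N_{E/ℚ}(X² − aX + (a² − 2c²)/4)`). [folklore]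
[cite: Marcus1977, Ch. 2 Thm. 1 and Cor. 2 (algebraic integers = roots of monic integer polynomials)] -/
theorem isIntegral_of_monic_sextic_eval {L : Type*} [Field L] (w : L) (c₀ c₁ c₂ c₃ c₄ c₅ : ℤ)
    (h : w ^ 6 + c₅ * w ^ 5 + c₄ * w ^ 4 + c₃ * w ^ 3 + c₂ * w ^ 2 + c₁ * w + c₀ = 0) : IsIntegral ℤ w := by
  refine ⟨X ^ 6 + Polynomial.C c₅ * X ^ 5 + Polynomial.C c₄ * X ^ 4 + Polynomial.C c₃ * X ^ 3 +
    Polynomial.C c₂ * X ^ 2 + Polynomial.C c₁ * X + Polynomial.C c₀, by monicity!, ?_⟩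
  simp only [eval₂_add, eval₂_mul, eval₂_pow, eval₂_X, eval₂_C]
  simpa only [algebraMap_int_eq, Int.coe_castRingHom] using h

/-! ## §1 The first layer `A = ℚ(θ) ⊔ ℚ_1` of a totally real cubic field `ℚ(θ)` -/

section Layer

variable {p q r : ℤ} {θ : AlgebraicClosure ℚ}

set_option maxHeartbeats 400000 in
/-- **The basic data of `A = ℚ(θ) ⊔ ℚ_1` for a TOTALLY REAL cubic field `ℚ(θ)` (`θ` a root of an irreducible integer cubic):
`A` is totally real, `[A : ℚ] = 6`, `[ℚ(θ) : ℚ] = 3`** — from the restricted cyclotomic `ℤ₂`-tower of `ℚ(θ)` (odd degree, so the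
cyclotomic character restricts onto): its first layer is `≅ ℚ(θ) ⊔ ℚ_1` and totally real as a layer of a `ℤ₂`-extension of a totally
real field. No hypothesis on the primes above `2`. k4-w1's `layer_one_basics_d63644` with the cubic freed.
[cite: Washington1997, §13.1 and Prop. 13.2] -/
theorem layer_one_basics (hirr : Irreducible (Cubic.toPoly ⟨1, (p : ℚ), q, r⟩))
    (hθ : aeval θ (Cubic.toPoly ⟨1, (p : ℚ), q, r⟩) = 0)
    (hreal : haveI : FiniteDimensional ℚ ↥ℚ⟮θ⟯ :=
        IntermediateField.adjoin.finiteDimensional ⟨_, Cubic.monic_of_a_eq_one', by rwa [← aeval_def]⟩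
      haveI : NumberField ↥ℚ⟮θ⟯ := NumberField.mk
      IsTotallyReal ↥ℚ⟮θ⟯) :
    haveI : FiniteDimensional ℚ ↥ℚ⟮θ⟯ :=
      IntermediateField.adjoin.finiteDimensional ⟨_, Cubic.monic_of_a_eq_one', by rwa [← aeval_def]⟩
    haveI : FiniteDimensional ℚ ↥((CyclotomicZp.zpExtension 2).layer 1) := (CyclotomicZp.zpExtension 2).finiteDimensional_layer_holds 1
    haveI : NumberField ↥(ℚ⟮θ⟯ ⊔ (CyclotomicZp.zpExtension 2).layer 1) := NumberField.mk
    IsTotallyReal ↥(ℚ⟮θ⟯ ⊔ (CyclotomicZp.zpExtension 2).layer 1) ∧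
      Module.finrank ℚ ↥(ℚ⟮θ⟯ ⊔ (CyclotomicZp.zpExtension 2).layer 1) = 6 ∧ Module.finrank ℚ ↥ℚ⟮θ⟯ = 3 := by
  haveI : FiniteDimensional ℚ ↥ℚ⟮θ⟯ :=
    IntermediateField.adjoin.finiteDimensional ⟨_, Cubic.monic_of_a_eq_one', by rwa [← aeval_def]⟩
  haveI : FiniteDimensional ℚ ↥((CyclotomicZp.zpExtension 2).layer 1) := (CyclotomicZp.zpExtension 2).finiteDimensional_layer_holds 1
  haveI : NumberField ↥ℚ⟮θ⟯ := NumberField.mk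
  haveI : NumberField ↥(ℚ⟮θ⟯ ⊔ (CyclotomicZp.zpExtension 2).layer 1) := NumberField.mk
  haveI : IsTotallyReal ↥ℚ⟮θ⟯ := hreal
  set κ := CyclotomicZp.zpExtension 2 with hκdef
  have h3 : Module.finrank ℚ ↥ℚ⟮θ⟯ = 3 := finrank_adjoin_eq_three_of_irreducible hirr hθ
  have hodd3 : Odd (Module.finrank ℚ ↥ℚ⟮θ⟯) := by rw [h3]; decide
  have hsurj := surjective_comp_absGaloisRestrict_cyclotomicZp_of_odd ℚ⟮θ⟯ hodd3
  set κE := κ.restrict ↥ℚ⟮θ⟯ hsurj with hκE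
  haveI : FiniteDimensional ↥ℚ⟮θ⟯ (κE.layer 1) := κE.finiteDimensional_layer_holds 1
  haveI : NumberField (κE.layer 1) := NumberField.of_module_finite ↥ℚ⟮θ⟯ _
  obtain ⟨f⟩ := nonempty_algEquiv_layer_restrict_fieldRange_sup_layer κ ↥ℚ⟮θ⟯ hsurj (ℚ⟮θ⟯).val 1
  have hrange : (ℚ⟮θ⟯).val.fieldRange ⊔ κ.layer 1 = ℚ⟮θ⟯ ⊔ κ.layer 1 := by rw [fieldRange_val]
  set e : ↥(κE.layer 1) ≃ₐ[ℚ] ↥(ℚ⟮θ⟯ ⊔ κ.layer 1) := f.trans (equivOfEq hrange) with hedef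
  haveI : IsTotallyReal ↥(κE.layer 1) := isTotallyReal_layer κE 1
  refine ⟨IsTotallyReal.ofRingEquiv e.toRingEquiv, ?_, h3⟩
  rw [← e.toLinearEquiv.finrank_eq, finrank_layer_restrict κ ↥ℚ⟮θ⟯ hsurj 1, h3]
  norm_num

/-- **`[A : ℚ(θ)] = 2`** for `A = ℚ(θ) ⊔ ℚ_1`, `ℚ(θ)` a totally real cubic field (with the inclusion algebra structure).
[cite: Washington1997, §13.1] -/
theorem finrank_sup_layer_one_eq_two (hirr : Irreducible (Cubic.toPoly ⟨1, (p : ℚ), q, r⟩))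
    (hθ : aeval θ (Cubic.toPoly ⟨1, (p : ℚ), q, r⟩) = 0)
    (hreal : haveI : FiniteDimensional ℚ ↥ℚ⟮θ⟯ :=
        IntermediateField.adjoin.finiteDimensional ⟨_, Cubic.monic_of_a_eq_one', by rwa [← aeval_def]⟩
      haveI : NumberField ↥ℚ⟮θ⟯ := NumberField.mk
      IsTotallyReal ↥ℚ⟮θ⟯) :
    haveI : FiniteDimensional ℚ ↥ℚ⟮θ⟯ :=
      IntermediateField.adjoin.finiteDimensional ⟨_, Cubic.monic_of_a_eq_one', by rwa [← aeval_def]⟩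
    haveI : FiniteDimensional ℚ ↥((CyclotomicZp.zpExtension 2).layer 1) := (CyclotomicZp.zpExtension 2).finiteDimensional_layer_holds 1
    letI : Algebra ↥ℚ⟮θ⟯ ↥(ℚ⟮θ⟯ ⊔ (CyclotomicZp.zpExtension 2).layer 1) :=
      (inclusion (le_sup_left : ℚ⟮θ⟯ ≤ ℚ⟮θ⟯ ⊔ (CyclotomicZp.zpExtension 2).layer 1)).toRingHom.toAlgebra
    Module.finrank ↥ℚ⟮θ⟯ ↥(ℚ⟮θ⟯ ⊔ (CyclotomicZp.zpExtension 2).layer 1) = 2 := by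
  haveI : FiniteDimensional ℚ ↥ℚ⟮θ⟯ :=
    IntermediateField.adjoin.finiteDimensional ⟨_, Cubic.monic_of_a_eq_one', by rwa [← aeval_def]⟩
  haveI : FiniteDimensional ℚ ↥((CyclotomicZp.zpExtension 2).layer 1) := (CyclotomicZp.zpExtension 2).finiteDimensional_layer_holds 1
  haveI : NumberField ↥ℚ⟮θ⟯ := NumberField.mk
  haveI : NumberField ↥(ℚ⟮θ⟯ ⊔ (CyclotomicZp.zpExtension 2).layer 1) := NumberField.mk
  obtain ⟨-, hfinA, h3⟩ := layer_one_basics hirr hθ hreal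
  have hKA : ℚ⟮θ⟯ ≤ ℚ⟮θ⟯ ⊔ ((CyclotomicZp.zpExtension 2).layer 1) := le_sup_left
  letI : Algebra ℚ⟮θ⟯ ↥(ℚ⟮θ⟯ ⊔ ((CyclotomicZp.zpExtension 2).layer 1)) := (inclusion hKA).toRingHom.toAlgebra
  haveI : IsScalarTower ℚ ℚ⟮θ⟯ ↥(ℚ⟮θ⟯ ⊔ ((CyclotomicZp.zpExtension 2).layer 1)) := IsScalarTower.of_algebraMap_eq fun q => ((inclusion hKA).commutes q).symm
  haveI : Module.Finite ℚ⟮θ⟯ ↥(ℚ⟮θ⟯ ⊔ ((CyclotomicZp.zpExtension 2).layer 1)) := Module.Finite.of_restrictScalars_finite ℚ ℚ⟮θ⟯ _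
  have htower := Module.finrank_mul_finrank ℚ ℚ⟮θ⟯ ↥(ℚ⟮θ⟯ ⊔ ((CyclotomicZp.zpExtension 2).layer 1))
  rw [h3, hfinA] at htower
  omega

set_option maxHeartbeats 400000 in
/-- **The real embeddings of `A = ℚ(θ) ⊔ ℚ_1` realise every pair `(φ, ±√2)`**, `φ` a real embedding of the totally real cubic `ℚ(θ)`:
`A` is totally real of degree `6`, `ρ ↦ (ρ|_{ℚ(θ)}, ρ(√2))` is injective (`A = ℚ(θ)(√2)`, `√2 ∉ ℚ(θ)` by odd degree) with image in the
`6`-set `Emb(ℚ(θ)) × {±√2}`. k4-w1's `exists_ringHom_sup_layer_one_d63644` with the cubic freed.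
[cite: FrohlichTaylor1990, Ch. V §1 ("the embeddings N ↪ ℝ"), p. 163] [cite: Washington1997, §13.1] [cite: Cohen1993, §4.1.3] -/
theorem exists_ringHom_sup_layer_one (hirr : Irreducible (Cubic.toPoly ⟨1, (p : ℚ), q, r⟩))
    (hθ : aeval θ (Cubic.toPoly ⟨1, (p : ℚ), q, r⟩) = 0)
    (hreal : haveI : FiniteDimensional ℚ ↥ℚ⟮θ⟯ :=
        IntermediateField.adjoin.finiteDimensional ⟨_, Cubic.monic_of_a_eq_one', by rwa [← aeval_def]⟩
      haveI : NumberField ↥ℚ⟮θ⟯ := NumberField.mk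
      IsTotallyReal ↥ℚ⟮θ⟯)
    {t : AlgebraicClosure ℚ} (ht : t ∈ (CyclotomicZp.zpExtension 2).layer 1) (ht2 : t ^ 2 = 2)
    (φ : ↥ℚ⟮θ⟯ →+* ℝ) (y : ℝ) (hy : y = Real.sqrt 2 ∨ y = -Real.sqrt 2) :
    ∃ ρ : ↥(ℚ⟮θ⟯ ⊔ (CyclotomicZp.zpExtension 2).layer 1) →+* ℝ,
      (∀ c : ↥ℚ⟮θ⟯, ρ (inclusion (le_sup_left : ℚ⟮θ⟯ ≤ ℚ⟮θ⟯ ⊔ (CyclotomicZp.zpExtension 2).layer 1) c) = φ c) ∧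
      ρ ⟨t, (le_sup_right : (CyclotomicZp.zpExtension 2).layer 1 ≤ _) ht⟩ = y := by
  haveI : FiniteDimensional ℚ ↥ℚ⟮θ⟯ :=
    IntermediateField.adjoin.finiteDimensional ⟨_, Cubic.monic_of_a_eq_one', by rwa [← aeval_def]⟩
  haveI : FiniteDimensional ℚ ↥((CyclotomicZp.zpExtension 2).layer 1) := (CyclotomicZp.zpExtension 2).finiteDimensional_layer_holds 1
  haveI : NumberField ↥ℚ⟮θ⟯ := NumberField.mk
  haveI : NumberField ↥(ℚ⟮θ⟯ ⊔ (CyclotomicZp.zpExtension 2).layer 1) := NumberField.mk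
  obtain ⟨hrealA, hfinA, h3⟩ := layer_one_basics hirr hθ hreal
  haveI := hrealA
  haveI : IsTotallyReal ↥ℚ⟮θ⟯ := hreal
  have hKA : ℚ⟮θ⟯ ≤ ℚ⟮θ⟯ ⊔ ((CyclotomicZp.zpExtension 2).layer 1) := le_sup_left
  have htA : t ∈ ℚ⟮θ⟯ ⊔ ((CyclotomicZp.zpExtension 2).layer 1) := (le_sup_right : ((CyclotomicZp.zpExtension 2).layer 1) ≤ ℚ⟮θ⟯ ⊔ ((CyclotomicZp.zpExtension 2).layer 1)) ht
  set t' : ↥(ℚ⟮θ⟯ ⊔ ((CyclotomicZp.zpExtension 2).layer 1)) := ⟨t, htA⟩ with ht'def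
  have ht'2 : t' ^ 2 = 2 := by
    apply (algebraMap ↥(ℚ⟮θ⟯ ⊔ ((CyclotomicZp.zpExtension 2).layer 1)) (AlgebraicClosure ℚ)).injective
    rw [map_pow, map_ofNat]
    exact ht2
  letI : Algebra ℚ⟮θ⟯ ↥(ℚ⟮θ⟯ ⊔ ((CyclotomicZp.zpExtension 2).layer 1)) := (inclusion hKA).toRingHom.toAlgebra
  have halg : ∀ c : ℚ⟮θ⟯, algebraMap ℚ⟮θ⟯ ↥(ℚ⟮θ⟯ ⊔ ((CyclotomicZp.zpExtension 2).layer 1)) c = inclusion hKA c := fun _ => rfl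
  haveI : IsScalarTower ℚ ℚ⟮θ⟯ ↥(ℚ⟮θ⟯ ⊔ ((CyclotomicZp.zpExtension 2).layer 1)) := IsScalarTower.of_algebraMap_eq fun q => ((inclusion hKA).commutes q).symm
  haveI : Module.Finite ℚ⟮θ⟯ ↥(ℚ⟮θ⟯ ⊔ ((CyclotomicZp.zpExtension 2).layer 1)) := Module.Finite.of_restrictScalars_finite ℚ ℚ⟮θ⟯ _
  have hdeg : Module.finrank ℚ⟮θ⟯ ↥(ℚ⟮θ⟯ ⊔ ((CyclotomicZp.zpExtension 2).layer 1)) = 2 := by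
    have htower := Module.finrank_mul_finrank ℚ ℚ⟮θ⟯ ↥(ℚ⟮θ⟯ ⊔ ((CyclotomicZp.zpExtension 2).layer 1))
    rw [h3, hfinA] at htower
    omega
  -- `√2 ∉ ℚ⟮θ⟯` (odd degree)
  have htK : t' ∉ Set.range (algebraMap ℚ⟮θ⟯ ↥(ℚ⟮θ⟯ ⊔ ((CyclotomicZp.zpExtension 2).layer 1))) := by
    rintro ⟨c, hc⟩
    have hc2 : c ^ 2 = 2 := by
      apply (algebraMap ℚ⟮θ⟯ ↥(ℚ⟮θ⟯ ⊔ ((CyclotomicZp.zpExtension 2).layer 1))).injective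
      rw [map_pow, hc, ht'2, map_ofNat]
    have hcQ : (c : AlgebraicClosure ℚ) ^ 2 = 2 := by
      have := congrArg (fun z : ↥ℚ⟮θ⟯ => (z : AlgebraicClosure ℚ)) hc2
      push_cast at this
      exact this
    have hcint : IsIntegral ℚ (c : AlgebraicClosure ℚ) := ⟨X ^ 2 - C 2, monic_X_pow_sub_C _ two_ne_zero, by simp [hcQ]⟩
    have hcnot : (c : AlgebraicClosure ℚ) ∉ (algebraMap ℚ (AlgebraicClosure ℚ)).range := by
      rintro ⟨q, hq⟩
      have h1 : (algebraMap ℚ (AlgebraicClosure ℚ)) (q ^ 2) = algebraMap ℚ (AlgebraicClosure ℚ) 2 := by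
        rw [map_pow, hq, hcQ, map_ofNat]
      have h2 : q ^ 2 = 2 := (algebraMap ℚ (AlgebraicClosure ℚ)).injective h1
      have hq2 : ((q : ℝ)) ^ 2 = 2 := by exact_mod_cast h2
      exact irrational_sqrt_two ⟨|q|, by rw [Rat.cast_abs, ← Real.sqrt_sq_eq_abs, hq2]⟩
    have hdeg2 : Module.finrank ℚ ↥ℚ⟮(c : AlgebraicClosure ℚ)⟯ = 2 := by
      rw [IntermediateField.adjoin.finrank hcint]
      have hle := (minpoly.two_le_natDegree_iff hcint).mpr hcnot
      have hle' : (minpoly ℚ (c : AlgebraicClosure ℚ)).natDegree ≤ 2 := by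
        have hd := minpoly.degree_le_of_ne_zero ℚ (c : AlgebraicClosure ℚ) (p := X ^ 2 - C (2 : ℚ))
          (monic_X_pow_sub_C (2 : ℚ) two_ne_zero).ne_zero (by simp [hcQ])
        rw [degree_X_pow_sub_C two_pos] at hd
        exact natDegree_le_iff_degree_le.mpr hd
      omega
    have hdvd : Module.finrank ℚ ↥ℚ⟮(c : AlgebraicClosure ℚ)⟯ ∣ Module.finrank ℚ ℚ⟮θ⟯ :=
      finrank_dvd_of_le_right ((adjoin_simple_le_iff).mpr c.2)
    rw [hdeg2, h3] at hdvd
    omega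
  -- `A = ℚ⟮θ⟯(t')`: every element is a polynomial in `t'` over `ℚ⟮θ⟯`
  have htint : IsIntegral ℚ⟮θ⟯ t' := (Algebra.IsIntegral.isIntegral (R := ℚ) t').tower_top
  have hgen : IntermediateField.adjoin ℚ⟮θ⟯ ({t'} : Set ↥(ℚ⟮θ⟯ ⊔ ((CyclotomicZp.zpExtension 2).layer 1))) = ⊤ := by
    have h2le : 2 ≤ (minpoly ℚ⟮θ⟯ t').natDegree := (minpoly.two_le_natDegree_iff htint).mpr htK
    refine IntermediateField.eq_of_le_of_finrank_eq le_top ?_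
    rw [IntermediateField.adjoin.finrank htint, IntermediateField.finrank_top', hdeg]
    exact le_antisymm ((minpoly.natDegree_le (A := ↥ℚ⟮θ⟯) (x := t')).trans hdeg.le) h2le
  have hpoly : ∀ z : ↥(ℚ⟮θ⟯ ⊔ ((CyclotomicZp.zpExtension 2).layer 1)), ∃ f : ℚ⟮θ⟯[X], z = aeval t' f := by
    intro z
    have hz : z ∈ (IntermediateField.adjoin ℚ⟮θ⟯ ({t'} : Set ↥(ℚ⟮θ⟯ ⊔ ((CyclotomicZp.zpExtension 2).layer 1)))).toSubalgebra := by
      rw [hgen, IntermediateField.top_toSubalgebra]; exact Algebra.mem_top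
    rw [IntermediateField.adjoin_simple_toSubalgebra_of_isAlgebraic htint.isAlgebraic, Algebra.adjoin_singleton_eq_range_aeval] at hz
    obtain ⟨f, hf⟩ := hz
    exact ⟨f, hf.symm⟩
  have hinj : ∀ ρ ρ' : ↥(ℚ⟮θ⟯ ⊔ ((CyclotomicZp.zpExtension 2).layer 1)) →+* ℝ, ρ.comp (algebraMap ℚ⟮θ⟯ ↥(ℚ⟮θ⟯ ⊔ ((CyclotomicZp.zpExtension 2).layer 1))) = ρ'.comp (algebraMap ℚ⟮θ⟯ ↥(ℚ⟮θ⟯ ⊔ ((CyclotomicZp.zpExtension 2).layer 1))) →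
      ρ t' = ρ' t' → ρ = ρ' := by
    intro ρ ρ' hc hval
    refine RingHom.ext fun z => ?_
    obtain ⟨f, rfl⟩ := hpoly z
    rw [aeval_def, hom_eval₂, hom_eval₂, hc, hval]
  -- counting
  have hcardA : Fintype.card (↥(ℚ⟮θ⟯ ⊔ ((CyclotomicZp.zpExtension 2).layer 1)) →+* ℝ) = 6 := by rw [card_realEmbeddings, hfinA]
  have hcardK : Fintype.card (↥ℚ⟮θ⟯ →+* ℝ) = 3 := by rw [card_realEmbeddings, h3]
  obtain ⟨hs2l, hs2u⟩ := sqrt_two_bounds'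
  have hsne : Real.sqrt 2 ≠ -Real.sqrt 2 := by intro h; linarith
  set Φ : (↥(ℚ⟮θ⟯ ⊔ ((CyclotomicZp.zpExtension 2).layer 1)) →+* ℝ) → (↥ℚ⟮θ⟯ →+* ℝ) × ℝ := fun ρ => (ρ.comp (algebraMap ℚ⟮θ⟯ ↥(ℚ⟮θ⟯ ⊔ ((CyclotomicZp.zpExtension 2).layer 1))), ρ t') with hΦ
  set S : Finset ((↥ℚ⟮θ⟯ →+* ℝ) × ℝ) := (Finset.univ : Finset (↥ℚ⟮θ⟯ →+* ℝ)) ×ˢ ({Real.sqrt 2, -Real.sqrt 2} : Finset ℝ) with hS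
  have hΦinj : Function.Injective Φ := fun ρ ρ' h => hinj ρ ρ' (congrArg Prod.fst h) (congrArg Prod.snd h)
  have hsub : Finset.univ.image Φ ⊆ S := by
    intro pt hp
    obtain ⟨ρ, -, rfl⟩ := Finset.mem_image.mp hp
    rw [hS, Finset.mem_product]
    refine ⟨Finset.mem_univ _, ?_⟩
    have hsq : (ρ t') ^ 2 = (Real.sqrt 2) ^ 2 := by
      rw [← map_pow, ht'2, map_ofNat, Real.sq_sqrt (by norm_num)]
    rcases sq_eq_sq_iff_eq_or_eq_neg.mp hsq with h | h
    · simp [hΦ, h]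
    · simp [hΦ, h]
  have hcardS : S.card = 6 := by
    rw [hS, Finset.card_product, Finset.card_univ, hcardK, Finset.card_pair hsne]
  have hcardI : (Finset.univ.image Φ).card = 6 := by
    rw [Finset.card_image_of_injective _ hΦinj, Finset.card_univ, hcardA]
  have heq : Finset.univ.image Φ = S := Finset.eq_of_subset_of_card_le hsub (by rw [hcardS, hcardI])
  have hmem : (φ, y) ∈ Finset.univ.image Φ := by
    rw [heq, hS, Finset.mem_product]
    refine ⟨Finset.mem_univ _, ?_⟩
    rcases hy with h | h <;> simp [h]
  obtain ⟨ρ, -, hρ⟩ := Finset.mem_image.mp hmem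
  refine ⟨ρ, fun c => ?_, congrArg Prod.snd hρ⟩
  have h1 := congrArg Prod.fst hρ
  simp only [hΦ] at h1
  rw [← halg, ← RingHom.comp_apply, h1]

/-- **`√2 ∉ ℚ(θ)`** for the totally real cubic `ℚ(θ)`, in the layer-`1` currency: `t' = √2 ∈ A` is not in the range of
`ℚ(θ) → A` (two real embeddings of `A` over the same `φ` separate it). [cite: Washington1997, §13.1] -/
theorem sqrt_two_not_mem_range (hirr : Irreducible (Cubic.toPoly ⟨1, (p : ℚ), q, r⟩))
    (hθ : aeval θ (Cubic.toPoly ⟨1, (p : ℚ), q, r⟩) = 0)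
    (hreal : haveI : FiniteDimensional ℚ ↥ℚ⟮θ⟯ :=
        IntermediateField.adjoin.finiteDimensional ⟨_, Cubic.monic_of_a_eq_one', by rwa [← aeval_def]⟩
      haveI : NumberField ↥ℚ⟮θ⟯ := NumberField.mk
      IsTotallyReal ↥ℚ⟮θ⟯)
    {t : AlgebraicClosure ℚ} (ht : t ∈ (CyclotomicZp.zpExtension 2).layer 1) (ht2 : t ^ 2 = 2) :
    haveI : FiniteDimensional ℚ ↥ℚ⟮θ⟯ :=
      IntermediateField.adjoin.finiteDimensional ⟨_, Cubic.monic_of_a_eq_one', by rwa [← aeval_def]⟩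
    letI : Algebra ↥ℚ⟮θ⟯ ↥(ℚ⟮θ⟯ ⊔ (CyclotomicZp.zpExtension 2).layer 1) :=
      (inclusion (le_sup_left : ℚ⟮θ⟯ ≤ ℚ⟮θ⟯ ⊔ (CyclotomicZp.zpExtension 2).layer 1)).toRingHom.toAlgebra
    (⟨t, (le_sup_right : (CyclotomicZp.zpExtension 2).layer 1 ≤ _) ht⟩ : ↥(ℚ⟮θ⟯ ⊔ (CyclotomicZp.zpExtension 2).layer 1)) ∉
      Set.range (algebraMap ↥ℚ⟮θ⟯ ↥(ℚ⟮θ⟯ ⊔ (CyclotomicZp.zpExtension 2).layer 1)) := by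
  haveI : FiniteDimensional ℚ ↥ℚ⟮θ⟯ :=
    IntermediateField.adjoin.finiteDimensional ⟨_, Cubic.monic_of_a_eq_one', by rwa [← aeval_def]⟩
  haveI : NumberField ↥ℚ⟮θ⟯ := NumberField.mk
  haveI : IsTotallyReal ↥ℚ⟮θ⟯ := hreal
  rintro ⟨c, hc⟩
  obtain ⟨ρ, hρK, hρt⟩ := exists_ringHom_sup_layer_one hirr hθ hreal ht ht2
    (InfinitePlace.embedding_of_isReal (IsTotallyReal.isReal (Classical.arbitrary (InfinitePlace ↥ℚ⟮θ⟯)))) (Real.sqrt 2) (Or.inl rfl)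
  obtain ⟨ρ', hρ'K, hρ't⟩ := exists_ringHom_sup_layer_one hirr hθ hreal ht ht2
    (InfinitePlace.embedding_of_isReal (IsTotallyReal.isReal (Classical.arbitrary (InfinitePlace ↥ℚ⟮θ⟯)))) (-Real.sqrt 2) (Or.inr rfl)
  have h1 : ρ ⟨t, (le_sup_right : (CyclotomicZp.zpExtension 2).layer 1 ≤ _) ht⟩ = ρ' ⟨t, (le_sup_right : (CyclotomicZp.zpExtension 2).layer 1 ≤ _) ht⟩ := by
    rw [← hc]
    show ρ (inclusion _ c) = ρ' (inclusion _ c)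
    rw [hρK, hρ'K]
  rw [hρt, hρ't] at h1
  have := sqrt_two_bounds'; linarith [this.1]


end Layer

end Summit.BirchSwinnertonDyer.BirchSwinnertonDyer.Theorems.AddKatoTwo

end
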